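import Summits.CriticalPhenomena.SAWScalingLimit.Theses.SAWPhaseRetrieval
import Summits.CriticalPhenomena.SAWScalingLimit.Theorems.SAWPhaseRetrievalRetrievalStabilityDiscAlgebra
import Summits.CriticalPhenomena.SAWScalingLimit.Theorems.SAWPhaseRetrievalRetrievalStabilityDiscLattice
import Summits.CriticalPhenomena.SAWScalingLimit.Theorems.SAWPhaseRetrievalRetrievalStabilityDiscPotential
import Summits.CriticalPhenomena.SAWScalingLimit.Theorems.SAWPhaseRetrievalRetrievalStabilityDiscCover
import Literature.Probability.LatticeModels.TriangularLatticeProofs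
import Literature.Barriers.CriticalPhenomena.ParafermionicHalfCauchyRiemann

/-!
# Retrieval stability, disc case — the box data at mesh `δ`

For the proof of `SAWPhaseRetrieval.RetrievalStabilityDisc` (stmt-CriticalPhenomena-11413).
At mesh `δ ≤ 1/200` with `ρ ≤ 1/(8δ)`: if every face whose scaled centre lies in the closed ball of
radius `2.95` belongs to the domain, then (i) the vertex relations give the up/down closures on
the lattice box `|a|, |b| ≤ 11ρ + 2`, hence a potential there (the Potential file), and (ii) the
phase hypothesis on the closed ball of radius `2` gives the phase bounds (and non-vanishing) for
the three edges at every up face `(![a,b],0)` with `|a|, |b|, |a+b| ≤ 11ρ + 2`.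
-/

namespace Summit.CriticalPhenomena.SAWScalingLimit.Theorems

open Literature.Probability.LatticeModels Literature.Probability.Percolation
  Literature.Probability.RandomPlanarGeometry.SAW Literature.Barriers.CriticalPhenomena
  Literature.Barriers.CriticalPhenomena.HexGreen Complex Finset


/-- `‖1 + ζ‖ ≤ 2`. [folklore] -/
theorem rsd_norm_one_add_triZeta_le : ‖(1 : ℂ) + triZeta‖ ≤ 2 := by
  calc ‖(1 : ℂ) + triZeta‖ ≤ ‖(1 : ℂ)‖ + ‖triZeta‖ := norm_add_le _ _
    _ = 2 := by rw [norm_one, norm_triZeta]; norm_num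

/-- Crude bound `‖a + bζ‖ ≤ |a| + |b|`. [folklore] -/
theorem rsd_norm_intvec_le_abs (a b : ℤ) : ‖(a : ℂ) + (b : ℂ) * triZeta‖ ≤ |(a : ℝ)| + |(b : ℝ)| := by
  calc ‖(a : ℂ) + (b : ℂ) * triZeta‖ ≤ ‖(a : ℂ)‖ + ‖(b : ℂ) * triZeta‖ := norm_add_le _ _
    _ = |(a : ℝ)| + |(b : ℝ)| := by
        rw [norm_mul, norm_triZeta, mul_one, Complex.norm_intCast, Complex.norm_intCast]

/-- **Faces of the box are in the domain.** If `|a|, |b| ≤ 11ρ + 2`, `ρ ≤ 1/(8δ)`, `δ ≤ 1/200`, then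
the scaled centres of both faces `(![a,b], k)` have norm `≤ 2.95`. [folklore] -/
theorem rsd_face_mem {Λ : Finset HexVertex} {δ : ℝ} {ρ : ℕ} (hδ0 : 0 < δ) (hδ : δ ≤ 1 / 200)
    (hρ : (ρ : ℝ) ≤ 1 / (8 * δ)) (hK : ∀ v : HexVertex, ‖(δ : ℂ) * hexCenter v‖ ≤ 2.95 → v ∈ Λ)
    {a b : ℤ} (ha : |a| ≤ 11 * ρ + 2) (hb : |b| ≤ 11 * ρ + 2) :
    ((![a, b] : Site 2), (0 : Fin 2)) ∈ Λ ∧ ((![a, b] : Site 2), (1 : Fin 2)) ∈ Λ := by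
  have haR : |(a : ℝ)| ≤ 11 * ρ + 2 := by
    have : ((|a| : ℤ) : ℝ) ≤ 11 * ρ + 2 := by exact_mod_cast ha
    simpa [Int.cast_abs] using this
  have hbR : |(b : ℝ)| ≤ 11 * ρ + 2 := by
    have : ((|b| : ℤ) : ℝ) ≤ 11 * ρ + 2 := by exact_mod_cast hb
    simpa [Int.cast_abs] using this
  have hv := rsd_norm_intvec_le_abs a b
  have hρδ : (ρ : ℝ) * δ ≤ 1 / 8 := by
    have h8 : (1 : ℝ) / (8 * δ) * δ = 1 / 8 := by field_simp
    have := mul_le_mul_of_nonneg_right hρ hδ0.le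
    rwa [h8] at this
  have key : ∀ k : Fin 2, ‖(δ : ℂ) * hexCenter (![a, b], k)‖ ≤ 2.95 := by
    intro k
    have hc : ‖hexCenter (![a, b], k)‖ ≤ |(a : ℝ)| + |(b : ℝ)| + 2 := by
      fin_cases k <;> simp only [Fin.zero_eta, Fin.isValue, Fin.mk_one]
      · rw [rsd_hexCenter_up]
        calc ‖(a : ℂ) + (b : ℂ) * triZeta + (1 + triZeta) / 3‖
            ≤ ‖(a : ℂ) + (b : ℂ) * triZeta‖ + ‖(1 + triZeta) / 3‖ := norm_add_le _ _
          _ ≤ |(a : ℝ)| + |(b : ℝ)| + 2 := by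
              rw [norm_div, Complex.norm_ofNat]
              linarith [rsd_norm_one_add_triZeta_le]
      · rw [rsd_hexCenter_down]
        calc ‖(a : ℂ) + (b : ℂ) * triZeta + 2 * (1 + triZeta) / 3‖
            ≤ ‖(a : ℂ) + (b : ℂ) * triZeta‖ + ‖2 * (1 + triZeta) / 3‖ := norm_add_le _ _
          _ ≤ |(a : ℝ)| + |(b : ℝ)| + 2 := by
              rw [norm_div, norm_mul, Complex.norm_ofNat, Complex.norm_ofNat]
              linarith [rsd_norm_one_add_triZeta_le]
    rw [norm_mul, Complex.norm_real, Real.norm_of_nonneg hδ0.le]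
    calc δ * ‖hexCenter (![a, b], k)‖ ≤ δ * (|(a : ℝ)| + |(b : ℝ)| + 2) :=
          mul_le_mul_of_nonneg_left hc hδ0.le
      _ ≤ δ * (22 * ρ + 6) := by apply mul_le_mul_of_nonneg_left _ hδ0.le; linarith
      _ = 22 * (ρ * δ) + 6 * δ := by ring
      _ ≤ 2.95 := by linarith
  exact ⟨hK _ (key 0), hK _ (key 1)⟩

/-- **Potential on the box.** From the vertex relations on the faces of the box we get a potential
with the three increment identities on `|a|, |b| ≤ 11ρ + 1`. [folklore] -/
theorem rsd_box_potential {Λ : Finset HexVertex} {G : Sym2 HexVertex → ℂ} {δ : ℝ} {ρ : ℕ}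
    (hδ0 : 0 < δ) (hδ : δ ≤ 1 / 200) (hρ : (ρ : ℝ) ≤ 1 / (8 * δ))
    (hK : ∀ v : HexVertex, ‖(δ : ℂ) * hexCenter v‖ ≤ 2.95 → v ∈ Λ)
    (hrel : SatisfiesVertexRelations Λ G) :
    ∃ p : ℤ → ℤ → ℂ,
      (∀ a b : ℤ, |a| ≤ 11 * ρ + 1 → |b| ≤ 11 * ρ + 1 → p (a + 1) b - p a b = G s((![a, b], 0), (![a, b - 1], 1))) ∧
      (∀ a b : ℤ, |b| ≤ 11 * ρ + 1 → p a (b + 1) - p a b = triZeta * G s((![a, b], 0), (![a - 1, b], 1))) ∧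
      (∀ a b : ℤ, |a| ≤ 11 * ρ + 1 → |b| ≤ 11 * ρ + 1 →
        p a (b + 1) - p (a + 1) b = (triZeta - 1) * G s((![a, b], 0), (![a, b], 1))) := by
  rw [satisfiesVertexRelations_iff_sum] at hrel
  set A : ℤ := -(11 * ρ + 2) with hA
  set M : ℕ := 22 * ρ + 4 with hM
  have hAM : A + (M : ℤ) = 11 * ρ + 2 := by rw [hA, hM]; push_cast; ring
  have hU : ∀ a b : ℤ, A ≤ a → a < A + M → A ≤ b → b < A + M →
      G s((![a, b], 0), (![a, b - 1], 1)) + (triZeta - 1) * G s((![a, b], 0), (![a, b], 1)) - triZeta * G s((![a, b], 0), (![a - 1, b], 1)) = 0 := by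
    intro a b h1 h2 h3 h4
    rw [hAM] at h2 h4
    have hm := (rsd_face_mem hδ0 hδ hρ hK (a := a) (b := b) (abs_le.2 ⟨by linarith, by linarith⟩)
      (abs_le.2 ⟨by linarith, by linarith⟩)).1
    exact rsd_up_closure (hrel _ hm)
  have hDn : ∀ a b : ℤ, A ≤ a → a < A + M → A ≤ b → b < A + M →
      G s((![a, b + 1], 0), (![a, b + 1 - 1], 1)) + (triZeta - 1) * G s((![a, b], 0), (![a, b], 1)) - triZeta * G s((![a + 1, b], 0), (![a + 1 - 1, b], 1)) = 0 := by
    intro a b h1 h2 h3 h4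
    rw [hAM] at h2 h4
    have hm := (rsd_face_mem hδ0 hδ hρ hK (a := a) (b := b) (abs_le.2 ⟨by linarith, by linarith⟩)
      (abs_le.2 ⟨by linarith, by linarith⟩)).2
    exact rsd_down_closure (hrel _ hm)
  obtain ⟨p, h1, h2, h3⟩ := rsd_potential_exists G A A M hU hDn
  refine ⟨p, fun a b ha hb => ?_, fun a b hb => ?_, fun a b ha hb => ?_⟩
  · have ha' := abs_le.1 ha; have hb' := abs_le.1 hb
    exact h1 a b (by linarith) (by linarith) (by linarith) (by linarith)
  · have hb' := abs_le.1 hb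
    exact h2 a b (by linarith)
  · have ha' := abs_le.1 ha; have hb' := abs_le.1 hb
    exact h3 a b (by linarith) (by linarith) (by linarith) (by linarith)

/-- **Phases on the box.** If `|a|, |b|, |a+b| ≤ 11ρ + 2` then the three edges at the up face
`(![a,b],0)` are mid-edges of the domain with scaled midpoints in the closed ball of radius `2`,
so the phase hypothesis applies: each value is non-zero and within `ε‖G‖` of `‖G‖`. [folklore] -/
theorem rsd_box_phase {Λ : Finset HexVertex} {G : Sym2 HexVertex → ℂ} {δ ε : ℝ} {ρ : ℕ}
    (hδ0 : 0 < δ) (hδ : δ ≤ 1 / 200) (hρ : (ρ : ℝ) ≤ 1 / (8 * δ))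
    (hK : ∀ v : HexVertex, ‖(δ : ℂ) * hexCenter v‖ ≤ 2.95 → v ∈ Λ)
    (hphase : ∀ e : Sym2 HexVertex, e ∈ hexDomainMidEdges Λ → ‖(δ : ℂ) * hexMidpoint e‖ ≤ 2 →
      G e ≠ 0 ∧ ‖G e / ((‖G e‖ : ℝ) : ℂ) - 1‖ ≤ ε)
    (a b : ℤ) (ha : |a| ≤ 11 * ρ + 2) (hb : |b| ≤ 11 * ρ + 2) (hab : |a + b| ≤ 11 * ρ + 2) :
    (‖G s((![a, b], 0), (![a, b - 1], 1)) - ((‖G s((![a, b], 0), (![a, b - 1], 1))‖ : ℝ) : ℂ)‖ ≤ ε * ‖G s((![a, b], 0), (![a, b - 1], 1))‖ ∧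
      ‖G s((![a, b], 0), (![a - 1, b], 1)) - ((‖G s((![a, b], 0), (![a - 1, b], 1))‖ : ℝ) : ℂ)‖ ≤ ε * ‖G s((![a, b], 0), (![a - 1, b], 1))‖ ∧
      ‖G s((![a, b], 0), (![a, b], 1)) - ((‖G s((![a, b], 0), (![a, b], 1))‖ : ℝ) : ℂ)‖ ≤ ε * ‖G s((![a, b], 0), (![a, b], 1))‖) ∧
    (G s((![a, b], 0), (![a, b - 1], 1)) ≠ 0 ∧ G s((![a, b], 0), (![a - 1, b], 1)) ≠ 0 ∧ G s((![a, b], 0), (![a, b], 1)) ≠ 0) := by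
  have haR : |(a : ℝ)| ≤ 11 * ρ + 2 := by
    have : ((|a| : ℤ) : ℝ) ≤ 11 * ρ + 2 := by exact_mod_cast ha
    simpa [Int.cast_abs] using this
  have hbR : |(b : ℝ)| ≤ 11 * ρ + 2 := by
    have : ((|b| : ℤ) : ℝ) ≤ 11 * ρ + 2 := by exact_mod_cast hb
    simpa [Int.cast_abs] using this
  have habR : |(a : ℝ) + b| ≤ 11 * ρ + 2 := by
    have : ((|a + b| : ℤ) : ℝ) ≤ 11 * ρ + 2 := by exact_mod_cast hab
    simpa [Int.cast_abs] using this
  have hv := rsd_norm_intvec_le haR hbR habR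
  have hρδ : (ρ : ℝ) * δ ≤ 1 / 8 := by
    have h8 : (1 : ℝ) / (8 * δ) * δ = 1 / 8 := by field_simp
    have := mul_le_mul_of_nonneg_right hρ hδ0.le
    rwa [h8] at this
  have hmem := rsd_mem_hexDomainMidEdges (rsd_face_mem hδ0 hδ hρ hK ha hb).1 (Λ := Λ)
  -- the three midpoints are within norm `‖a + bζ‖ + 1`
  have hoff : ∀ off : ℂ, ‖off‖ ≤ 1 →
      ‖(δ : ℂ) * ((a : ℂ) + (b : ℂ) * triZeta + off)‖ ≤ 2 := by
    intro off hoff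
    rw [norm_mul, Complex.norm_real, Real.norm_of_nonneg hδ0.le]
    calc δ * ‖(a : ℂ) + (b : ℂ) * triZeta + off‖ ≤ δ * (‖(a : ℂ) + (b : ℂ) * triZeta‖ + ‖off‖) :=
          mul_le_mul_of_nonneg_left (norm_add_le _ _) hδ0.le
      _ ≤ δ * (5 / 4 * (11 * ρ + 2) + 1) := by
          apply mul_le_mul_of_nonneg_left _ hδ0.le; linarith
      _ = 55 / 4 * (ρ * δ) + 7 / 2 * δ := by ring
      _ ≤ 2 := by linarith
  have oC : ‖(1 / 2 : ℂ)‖ ≤ 1 := by norm_num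
  have oB : ‖triZeta / 2‖ ≤ 1 := by rw [norm_div, norm_triZeta]; norm_num
  have oA : ‖(1 + triZeta) / 2‖ ≤ 1 := by
    rw [norm_div, Complex.norm_ofNat]; linarith [rsd_norm_one_add_triZeta_le]
  have pC := hphase _ hmem.2.2 (by rw [rsd_hexMidpoint_C]; exact hoff _ oC)
  have pB := hphase _ hmem.2.1 (by rw [rsd_hexMidpoint_B]; exact hoff _ oB)
  have pA := hphase _ hmem.1 (by rw [rsd_hexMidpoint_A]; exact hoff _ oA)
  exact ⟨⟨rsd_norm_sub_norm_le pC.1 pC.2, rsd_norm_sub_norm_le pB.1 pB.2,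
    rsd_norm_sub_norm_le pA.1 pA.2⟩, pC.1, pB.1, pA.1⟩

end Summit.CriticalPhenomena.SAWScalingLimit.Theorems
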